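import Summits.QuantumFields.YangMills.Theorems.BalabanUVNodesK0RecordFormatNamesFluct

/-!
# NODE O port PT-A — THE BRACKET `[log Z^{(k)}(U) − log Z^{(k)}(1)]` IS FREE OF THE CONSTRAINT BASIS: under a change `C ↦ C·A` of the parametrisation `B′ = CB` of `{Q̃B′ = 0}`
# (`A` invertible) the difference of (1.4)-normalisations at two backgrounds is unchanged (`det((CA)ᵀ S (CA)) = (det A)² det(Cᵀ S C)`) — so DEF-1's `recordZk`∕`recordLogZk`
# (ed.15 ✓p801852, `recordCop` = an ARBITRARY basis of `ker LQ̃` via `Module.finBasis`) give the SAME bracket as print's LOCAL parametrisation `C` (p.268 «C is the operator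
# determined by the configuration V^{(k)}»), on which alone the random-walk localisation of [16] (63) can run

Cell `ym-nodeO-ideate`, porter seat `ymgap-nodeO-port-PTA-1` (gen 3); `--supports stmt-QuantumFields-27930` (helper).  [I] = [Balaban1987RG1], [16] = [Balaban1985UVStability3D].
LOCATED (for DEF-1 ed.15b ∕ the (T3) porter): `recordCop` is fine for the SPLIT's `Φ₁ = recordLogZk(U_B) − recordLogZk(1)` (this file), but the entries of `recordPrec = Cᵀ S C` in an
arbitrary basis are NOT local — the walk expansion of `(Cᵀ S C + x)⁻¹` needs print's local `C` (identity on the non-`b₀` bonds, `−h(c)·(LQ̃|…)` on `b₀(c)`); the twin `recordCopLoc` +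
this file's bridge is the road.
* §1 `transpose_mul_mul_mul_basis` — `(C·A)ᵀ S (C·A) = Aᵀ (Cᵀ S C) A`; `det_conj_basis` — its determinant is `(det A)² · det(Cᵀ S C)`.
* §2 `posDef_conj_basis` — positivity passes along an invertible basis change (`Matrix.PosDef.conjTranspose_mul_mul_same`).
* §3 ★ `logZ14_sub_basis_change` — `logZ14 S₁ (C·A) − logZ14 S₀ (C·A) = logZ14 S₁ C − logZ14 S₀ C` (the `log|det A|²` cancels; `B12Eq15QuadraticForm.logZ14_sub`).
* §4 (v2 APPEND) ★ `Z14_basis_change` — `Z14 S (C·A) = Z14 S C ∕ |det A|`; `Z14_basis_change_of_abs_det_eq_one`.  LOCATED: at two DIFFERENT backgrounds the SAME-basis cancellation of §3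
  is unavailable — `recordZk` needs print's (1.4) normalisation (the δ-function's Jacobian), see the §4 header.

HONEST FRAMING.  Linear algebra; NOTHING of Bałaban asserted (not the positivity of the record's `Cᵀ S C`); 27930 OPEN; K0⁷ NOT closed; NODE O 0∕1; COUNT 8∕28 · K 1∕4 UNMOVED; finite
`𝕋⁴_{L^K}` at fixed ε — NOT continuum ∕ OS ∕ Clay; **the Yang–Mills mass gap is NOT proved by any of this.**  No `sorry`, no `def`, no `instance`; standard axioms.
-/

noncomputable section

namespace Summit.QuantumFields.YangMills.Theorems.BalabanUVNodesPortS1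

open Literature.MathematicalPhysics.QuantumFieldTheory.Balaban1983to89
open _root_.Matrix

variable {ι ρ : Type*} [Fintype ι] [Fintype ρ] [DecidableEq ρ]

/-! ## §1  The congruence algebra -/

omit [DecidableEq ρ] in
/-- `(C·A)ᵀ S (C·A) = Aᵀ (Cᵀ S C) A`. [cite: Balaban1987RG1, (1.4) p.260 (bookkeeping)] -/
theorem transpose_mul_mul_mul_basis (S : Matrix ι ι ℝ) (C : Matrix ι ρ ℝ) (A : Matrix ρ ρ ℝ) :
    (C * A)ᵀ * S * (C * A) = Aᵀ * (Cᵀ * S * C) * A := by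
  rw [transpose_mul]
  simp only [Matrix.mul_assoc]

/-- `det((C·A)ᵀ S (C·A)) = (det A)² · det(Cᵀ S C)`. [cite: Balaban1987RG1, (1.4) p.260 (bookkeeping)] -/
theorem det_conj_basis (S : Matrix ι ι ℝ) (C : Matrix ι ρ ℝ) (A : Matrix ρ ρ ℝ) :
    ((C * A)ᵀ * S * (C * A)).det = A.det ^ 2 * (Cᵀ * S * C).det := by
  rw [transpose_mul_mul_mul_basis, det_mul, det_mul, det_transpose]
  ring

/-! ## §2  Positivity along a basis change -/

/-- Positive-definiteness of `Cᵀ S C` passes to `(C·A)ᵀ S (C·A)` for `A` invertible. [cite: Balaban1987RG1, (1.4) p.260 (bookkeeping)] -/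
theorem posDef_conj_basis (S : Matrix ι ι ℝ) (C : Matrix ι ρ ℝ) (A : Matrix ρ ρ ℝ) (h : (Cᵀ * S * C).PosDef) (hA : IsUnit A.det) :
    ((C * A)ᵀ * S * (C * A)).PosDef := by
  rw [transpose_mul_mul_mul_basis, ← conjTranspose_eq_transpose_of_trivial]
  refine h.conjTranspose_mul_mul_same ?_
  exact Matrix.mulVec_injective_iff_isUnit.mpr ((Matrix.isUnit_iff_isUnit_det A).mpr hA)

/-! ## §3  ★ The bracket is basis-free -/

/-- ★ **`[log Z^{(k)}(U) − log Z^{(k)}(1)]` DOES NOT DEPEND ON THE BASIS OF THE CONSTRAINT KERNEL**: for two background matrices `S₁, S₀` (positive on the kernel) and an invertible change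
`A` of the parametrisation `C`, `logZ14 S₁ (C·A) − logZ14 S₀ (C·A) = logZ14 S₁ C − logZ14 S₀ C`.  (So DEF-1's arbitrary-basis `recordLogZk` and print's local-`C` normalisation give the
same Φ₁; the localisation runs on the local one.) [cite: Balaban1987RG1, (1.3)–(1.4) p.260, p.268] -/
theorem logZ14_sub_basis_change (S₁ S₀ : Matrix ι ι ℝ) (C : Matrix ι ρ ℝ) (A : Matrix ρ ρ ℝ)
    (h₁ : (Cᵀ * S₁ * C).PosDef) (h₀ : (Cᵀ * S₀ * C).PosDef) (hA : IsUnit A.det) :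
    B12Eq15QuadraticForm.logZ14 S₁ (C * A) - B12Eq15QuadraticForm.logZ14 S₀ (C * A) =
      B12Eq15QuadraticForm.logZ14 S₁ C - B12Eq15QuadraticForm.logZ14 S₀ C := by
  rw [B12Eq15QuadraticForm.logZ14_sub S₁ S₀ (C * A) (posDef_conj_basis S₁ C A h₁ hA) (posDef_conj_basis S₀ C A h₀ hA),
    B12Eq15QuadraticForm.logZ14_sub S₁ S₀ C h₁ h₀, det_conj_basis, det_conj_basis]
  have hA2 : 0 < A.det ^ 2 := by
    have hne : A.det ≠ 0 := hA.ne_zero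
    positivity
  rw [Real.log_mul hA2.ne' h₁.det_pos.ne', Real.log_mul hA2.ne' h₀.det_pos.ne']
  ring

/-! ## §4  (v2 APPEND) `Z^{(k)}` ITSELF under a basis change: `Z14 S (C·A) = Z14 S C ∕ |det A|` — so an ARBITRARY basis of `ker LQ̃(V^{(k)})` (DEF-1 `recordCop := Module.finBasis`)
fixes `Z^{(k)}` only up to a factor that depends on the basis chosen for THAT kernel; at two different backgrounds (`V^{(k)}(W_B)` vs `1`) the factors are unrelated — LOCATED for ed.15b:
print's (1.4) `Z^{(j)}(U_k) = ∫dB δ(Q̃B) exp[−½⟨B, Δ^{(j)}(U_k)B⟩]` carries the δ-function's OWN normalisation (`det(LQ̃ LQ̃ᵀ)^{−1∕2}` against an orthonormal kernel basis, resp.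
`|det LQ̃|_{b₀}|⁻¹` against print's graph coordinates over the non-`b₀` bonds), which a faithful `recordZk` must include; orthonormal bases are interchangeable (`|det A| = 1`). -/

/-- **`Z14` under a change of the kernel basis**: `Z14 S (C·A) = Z14 S C ∕ |det A|` (`A` invertible, `Cᵀ S C` positive definite). [cite: Balaban1987RG1, (1.4) p.260] -/
theorem Z14_basis_change (S : Matrix ι ι ℝ) (C : Matrix ι ρ ℝ) (A : Matrix ρ ρ ℝ) (h : (Cᵀ * S * C).PosDef) (hA : IsUnit A.det) :
    B12Eq15QuadraticForm.Z14 S (C * A) = B12Eq15QuadraticForm.Z14 S C / |A.det| := by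
  rw [B12Eq15QuadraticForm.Z14_eq S (C * A) (posDef_conj_basis S C A h hA), B12Eq15QuadraticForm.Z14_eq S C h, det_conj_basis,
    Real.sqrt_mul (sq_nonneg _), Real.sqrt_sq_eq_abs, div_div, mul_comm |A.det|]

/-- **Orthonormal-type basis changes do not move `Z14`**: `|det A| = 1 ⟹ Z14 S (C·A) = Z14 S C` — any two orthonormal bases of the kernel give the SAME normalisation.
[cite: Balaban1987RG1, (1.4) p.260 (bookkeeping)] -/
theorem Z14_basis_change_of_abs_det_eq_one (S : Matrix ι ι ℝ) (C : Matrix ι ρ ℝ) (A : Matrix ρ ρ ℝ) (h : (Cᵀ * S * C).PosDef) (hA : |A.det| = 1) :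
    B12Eq15QuadraticForm.Z14 S (C * A) = B12Eq15QuadraticForm.Z14 S C := by
  have hA' : IsUnit A.det := by
    rw [isUnit_iff_ne_zero]
    intro h0
    rw [h0, abs_zero] at hA
    exact zero_ne_one hA
  rw [Z14_basis_change S C A h hA', hA, div_one]

end Summit.QuantumFields.YangMills.Theorems.BalabanUVNodesPortS1

end
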